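import Literature.NumberTheory.Sieve.FejerKernelCounting
import HarnessLib

/-!
# The Fejér-smoothed indicator of an arc and the separation of `sign(Re wz)` (Friedlander–Iwaniec (20.16)–(20.19))

Topic `NumberTheory/Sieve` (harmonic analysis on the circle in the elementary, finite form of
`FejerKernelCounting.lean`). Source of the application: J. Friedlander, H. Iwaniec, Ann. of Math. (2)
148 (1998), 945–1040 [FriedlanderIwaniecAnnals1998], §20, (20.15)–(20.19) (arXiv math/9811185,
p. 75): "The formula (20.15) reduces the problem of the separation of variables in `ε(w, z)` to that
in `sign(Re wz)`, and the latter requires an application of harmonic analysis … `sign(Re wz) = t(arg wz)`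
where `t(α)` is the periodic function of period `2π` which is even, takes value `1` if `0 ≤ α < π/2` and
`−1` if `π/2 < α ≤ π`. Since `wz` is not purely imaginary because of `wz ≡ 1 (mod 2)`, we can smooth
`t(α)` slightly at `α = π/2` without altering the values … if `w, z` are restricted by `|wz| ≤ R` and
`wz ≡ 1 (mod 2)` then `wz` stays away from the imaginary axis by an angle `R⁻¹` and this is sufficient
room for the modification of `t(α)` so that (20.18) `Σ_k |t̂(k)| ≪ log 2R`. By (20.16) and (20.17) we
write (20.19) `sign(Re wz) = Σ_k t̂(k) (wz/|wz|)^k`."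

This file PROVES a finite version of that device which is all the applications (Propositions 21.4,
23.1) need: instead of an exactly modified `t` we smooth the indicator of the arc with the FEJÉR
KERNEL `K_H` of the tree (`FejerCounting.fejerKernel`), obtaining a trigonometric POLYNOMIAL whose
coefficients have `ℓ¹` norm `≤ 2 + (4/π)(1 + log(H+1))` and which agrees with `sign(Re z)` up to
`2π/((H+1)ρ)` at every `z` with `|Re z| ≥ ρ|z|` — so the error is made negligible by taking `H` a
power of the relevant parameters, at logarithmic cost, exactly as in (20.18). No named facts.

## Contents

* `smoothInd H a b y = ∫_a^b K_H(y − t) dt` (`= (𝟙_{[a,b]} * K_H)(y)`): `smoothInd_eq_integral`,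
  periodicity `smoothInd_add_intCast`, `0 ≤ S_H ≤ 1` (`smoothInd_nonneg`, `smoothInd_le_one`),
  **inside** `le_smoothInd_of_mem` (`S_H ≥ 1 − 1/(2(H+1)δ)` on `[a+δ, b−δ]`), **outside**
  `smoothInd_le_of_not_mem` (`S_H ≤ 1/(2(H+1)δ)` on `[b+δ, a+1−δ]`), from the kernel-mass bounds
  `le_integral_fejerKernel_near_zero`, `integral_fejerKernel_tail_le` of the tree.
* `coef`, `smoothInd_eq_sum` (`S_H(y) = Σ_{n,n' ≤ H+1} γ(n,n') e((n−n')y)`), `sum_inv_abs_le`,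
  **`sum_norm_coef_le`** (`Σ|γ| ≤ (b−a) + (2/π)(1 + log(H+1))`, via `sum_sum_erase_le`,
  `norm_integral_fourierChar_mul_le` of the tree and Mathlib's `harmonic_le_one_add_log`).
* `angleFrac z = arg z/2π`, `fourierChar_intCast_mul_angleFrac` (`e(mθ(z)) = (z/|z|)^m`),
  `div_norm_mul`; `smoothSign H z = 2 S_H(θ(z)) − 1` for the arc `|θ| ≤ 1/4`; `abs_arg_le_of_re_ge`,
  `le_abs_arg_of_re_le` (angular room `ρ` from `|Re z| ≥ ρ|z|`, through `cos(arg z) = Re z/|z|`,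
  `arccos` and `sin ρ ≤ ρ`); **`abs_smoothSign_sub_sign_le`** (`|T_H(z) − sign(Re z)| ≤ 2π/((H+1)ρ)`);
  `smoothSign_eq_sum`, `sum_norm_two_mul_coef_le`.
* **`norm_sum_sum_sign_mul_le`** — the separation inside a double sum:
  `‖ΣΣ sign(Re(w_i z_j)) F(i,j)‖ ≤ (2 + (4/π)(1+log(H+1))) M + (2π/((H+1)ρ)) ΣΣ ‖F(i,j)‖` whenever all
  twisted sums `ΣΣ (w_i/|w_i|)^d (z_j/|z_j|)^d F(i,j)`, `|d| ≤ H`, are bounded by `M`.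

## References

* J. Friedlander, H. Iwaniec, Ann. of Math. (2) 148 (1998), 945–1040, §20, (20.15)–(20.19).
  [FriedlanderIwaniecAnnals1998]
* H. L. Montgomery, *Ten lectures on the interface between analytic number theory and harmonic
  analysis*, CBMS 84 (1994), Ch. 1 (Fejér kernel; as in `FejerKernelCounting`).

## Tree / Mathlib

Tree: `FejerCounting.fejerKernel` and its API (`fejerKernel_nonneg`, `fejerKernel_add_intCast`,
`integral_fejerKernel`, `le_integral_fejerKernel_near_zero`, `integral_fejerKernel_tail_le`,
`integral_fejerKernel_sub_eq_sum`, `sum_sum_erase_le`, `norm_integral_fourierChar_mul_le`,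
`intervalIntegrable_fejerKernel`). Mathlib: `intervalIntegral.integral_comp_sub_left`,
`intervalIntegral.integral_mono_interval`, `harmonic_le_one_add_log`, `Complex.cos_arg`,
`Complex.norm_mul_exp_arg_mul_I`, `Complex.exp_int_mul`, `Real.arccos_cos`, `Real.antitone_arccos`,
`Real.arccos_eq_pi_div_two_sub_arcsin`, `Real.le_arcsin_iff_sin_le'`, `Real.sin_le`.
-/

noncomputable section

open Finset Real MeasureTheory intervalIntegral
open scoped FourierTransform

namespace Literature.NumberTheory.Sieve.FejerSmoothing

open Literature.NumberTheory.Sieve.FejerCounting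

/-! ### The smoothed indicator `S_H(y) = ∫_a^b K_H(y − t) dt` -/

/-- The Fejér-smoothed indicator of `[a, b]` (modulo `1`): `S_H(y) = ∫_a^b K_H(y − t) dt = (𝟙_{[a,b]} * K_H)(y)`.
[folklore] -/
def smoothInd (H : ℕ) (a b y : ℝ) : ℝ := ∫ t in a..b, fejerKernel H (y - t)

variable (H : ℕ)

/-- Change of variables: `S_H(y) = ∫_{y−b}^{y−a} K_H`. [folklore] -/
theorem smoothInd_eq_integral (a b y : ℝ) : smoothInd H a b y = ∫ u in (y - b)..(y - a), fejerKernel H u := by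
  rw [smoothInd, intervalIntegral.integral_comp_sub_left (fun u => fejerKernel H u) y]

/-- `S_H` is `1`-periodic. [folklore] -/
theorem smoothInd_add_intCast (a b y : ℝ) (k : ℤ) : smoothInd H a b (y + k) = smoothInd H a b y := by
  rw [smoothInd, smoothInd]
  refine intervalIntegral.integral_congr fun t _ => ?_
  show fejerKernel H (y + k - t) = fejerKernel H (y - t)
  rw [show y + k - t = (y - t) + k by ring, fejerKernel_add_intCast]

/-- `S_H ≥ 0` for `a ≤ b`. [folklore] -/
theorem smoothInd_nonneg {a b : ℝ} (hab : a ≤ b) (y : ℝ) : 0 ≤ smoothInd H a b y := by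
  rw [smoothInd_eq_integral]
  exact intervalIntegral.integral_nonneg (by linarith) fun u _ => fejerKernel_nonneg H u

/-- `S_H ≤ 1` for `0 ≤ b − a ≤ 1` (the kernel has mass `1` on a period). [folklore] -/
theorem smoothInd_le_one {a b : ℝ} (hab : a ≤ b) (hba : b - a ≤ 1) (y : ℝ) : smoothInd H a b y ≤ 1 := by
  rw [smoothInd_eq_integral]
  calc ∫ u in (y - b)..(y - a), fejerKernel H u ≤ ∫ u in (y - b)..(y - b + 1), fejerKernel H u :=
        intervalIntegral.integral_mono_interval le_rfl (by linarith) (by linarith)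
          (Filter.Eventually.of_forall fun u => fejerKernel_nonneg H u) (intervalIntegrable_fejerKernel H _ _)
    _ = 1 := integral_fejerKernel H _

/-- **Inside the arc**: for `a + δ ≤ y ≤ b − δ` (`0 < δ ≤ 1/2`), `S_H(y) ≥ 1 − 1/(2(H+1)δ)`.
[folklore] -/
theorem le_smoothInd_of_mem {a b δ y : ℝ} (hδ : 0 < δ) (hδ2 : δ ≤ 1 / 2) (hy1 : a + δ ≤ y) (hy2 : y ≤ b - δ) :
    1 - 1 / (2 * (H + 1) * δ) ≤ smoothInd H a b y := by
  rw [smoothInd_eq_integral]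
  calc 1 - 1 / (2 * (H + 1) * δ) ≤ ∫ u in (-δ)..δ, fejerKernel H u := le_integral_fejerKernel_near_zero H hδ hδ2
    _ ≤ ∫ u in (y - b)..(y - a), fejerKernel H u :=
        intervalIntegral.integral_mono_interval (by linarith) (by linarith) (by linarith)
          (Filter.Eventually.of_forall fun u => fejerKernel_nonneg H u) (intervalIntegrable_fejerKernel H _ _)

/-- **Outside the arc**: for `b + δ ≤ y ≤ a + 1 − δ` (`0 < δ ≤ 1/2`), `S_H(y) ≤ 1/(2(H+1)δ)`.
[folklore] -/
theorem smoothInd_le_of_not_mem {a b δ y : ℝ} (hδ : 0 < δ) (hδ2 : δ ≤ 1 / 2) (hy1 : b + δ ≤ y)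
    (hy2 : y ≤ a + 1 - δ) : smoothInd H a b y ≤ 1 / (2 * (H + 1) * δ) := by
  rw [smoothInd_eq_integral]
  rcases le_or_gt a b with hab | hab
  · calc ∫ u in (y - b)..(y - a), fejerKernel H u ≤ ∫ u in δ..(1 - δ), fejerKernel H u :=
          intervalIntegral.integral_mono_interval (by linarith) (by linarith) (by linarith)
            (Filter.Eventually.of_forall fun u => fejerKernel_nonneg H u) (intervalIntegrable_fejerKernel H _ _)
      _ ≤ 1 / (2 * (H + 1) * δ) := integral_fejerKernel_tail_le H hδ hδ2
  · rw [intervalIntegral.integral_of_ge (by linarith)]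
    have : 0 ≤ ∫ u in Set.Ioc (y - a) (y - b), fejerKernel H u :=
      MeasureTheory.setIntegral_nonneg measurableSet_Ioc fun u _ => fejerKernel_nonneg H u
    have h2 : 0 ≤ 1 / (2 * ((H : ℝ) + 1) * δ) := by positivity
    linarith

/-! ### `S_H` as a trigonometric polynomial with `ℓ¹`-small coefficients -/

/-- The coefficients `γ(n, n') = (H+1)⁻¹ ∫_a^b e((n' − n) t) dt` of the expansion
`S_H(y) = Σ_{n, n' = 1}^{H+1} γ(n, n') e((n − n') y)`. [folklore] -/
def coef (H : ℕ) (a b : ℝ) (n n' : ℕ) : ℂ := ((H : ℂ) + 1)⁻¹ * ∫ t in a..b, (𝐞 (((n' : ℝ) - n) * t) : ℂ)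

/-- **The expansion**: `S_H(y) = Σ_{n, n' ≤ H+1} γ(n, n') e((n − n') y)`. [folklore] -/
theorem smoothInd_eq_sum (a b y : ℝ) : (smoothInd H a b y : ℂ) =
    ∑ n ∈ Ioc 0 (H + 1), ∑ n' ∈ Ioc 0 (H + 1), coef H a b n n' * (𝐞 (((n : ℝ) - n') * y) : ℂ) := by
  rw [smoothInd, integral_fejerKernel_sub_eq_sum, mul_sum]
  refine sum_congr rfl fun n _ => ?_
  rw [mul_sum]
  refine sum_congr rfl fun n' _ => ?_
  rw [coef]; ring

/-- `Σ_{0 < |d| ≤ H} 1/(π|d|) ≤ (2/π)(1 + log(H + 1))`. [folklore] -/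
theorem sum_inv_abs_le : ∑ d ∈ (Icc (-(H : ℤ)) H).erase 0, 1 / (Real.pi * |(d : ℝ)|) ≤
    2 / Real.pi * (1 + Real.log (H + 1)) := by
  have hπ := Real.pi_pos
  -- split into positive and negative `d`
  have hsplit : (Icc (-(H : ℤ)) H).erase 0 = (Icc (1 : ℤ) H) ∪ (Icc (-(H : ℤ)) (-1)) := by
    ext d; simp only [mem_erase, mem_Icc, mem_union]; omega
  have hdisj : Disjoint (Icc (1 : ℤ) H) (Icc (-(H : ℤ)) (-1)) := by
    rw [disjoint_left]; intro d hd hd'; rw [mem_Icc] at hd hd'; omega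
  rw [hsplit, sum_union hdisj]
  -- the harmonic bound
  have hharm : ∑ d ∈ Icc (1 : ℤ) H, 1 / (Real.pi * |(d : ℝ)|) ≤ 1 / Real.pi * (1 + Real.log (H + 1)) := by
    have h1 : ∑ d ∈ Icc (1 : ℤ) H, 1 / (Real.pi * |(d : ℝ)|) = 1 / Real.pi * ∑ i ∈ Icc 1 H, ((i : ℝ))⁻¹ := by
      rw [mul_sum]
      refine sum_nbij' (fun d => d.toNat) (fun i => (i : ℤ)) ?_ ?_ ?_ ?_ ?_
      · intro d hd; rw [mem_Icc] at hd ⊢; omega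
      · intro i hi; rw [mem_Icc] at hi ⊢; omega
      · intro d hd; rw [mem_Icc] at hd; exact Int.toNat_of_nonneg (by omega)
      · intro i _; simp
      · intro d hd
        rw [mem_Icc] at hd
        have hd0 : (0 : ℝ) < d := by exact_mod_cast hd.1
        have hdz : ((d.toNat : ℕ) : ℤ) = d := Int.toNat_of_nonneg (by omega)
        have hdr : ((d.toNat : ℕ) : ℝ) = (d : ℝ) := by exact_mod_cast hdz
        rw [abs_of_pos hd0, hdr]
        field_simp
    rw [h1]
    refine mul_le_mul_of_nonneg_left ?_ (by positivity)
    have h2 := harmonic_le_one_add_log (H + 1)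
    rw [harmonic_eq_sum_Icc] at h2
    push_cast at h2
    calc ∑ i ∈ Icc 1 H, ((i : ℝ))⁻¹ ≤ ∑ i ∈ Icc 1 (H + 1), ((i : ℝ))⁻¹ :=
          sum_le_sum_of_subset_of_nonneg (Icc_subset_Icc_right (Nat.le_succ H)) fun i _ _ => by positivity
      _ ≤ 1 + Real.log (H + 1) := by exact_mod_cast h2
  have hneg : ∑ d ∈ Icc (-(H : ℤ)) (-1), 1 / (Real.pi * |(d : ℝ)|) = ∑ d ∈ Icc (1 : ℤ) H, 1 / (Real.pi * |(d : ℝ)|) := by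
    refine sum_nbij' (fun d => -d) (fun d => -d) ?_ ?_ ?_ ?_ ?_
    · intro d hd; rw [mem_Icc] at hd ⊢; omega
    · intro d hd; rw [mem_Icc] at hd ⊢; omega
    · intro d _; simp
    · intro d _; simp
    · intro d _; simp [abs_neg]
  rw [hneg]
  have : 2 / Real.pi * (1 + Real.log (H + 1)) = 2 * (1 / Real.pi * (1 + Real.log (H + 1))) := by ring
  linarith

/-- **The `ℓ¹` bound for the coefficients**:
`Σ_{n, n'} |γ(n, n')| ≤ (b − a) + (2/π)(1 + log(H+1))` for `a ≤ b`. [folklore] -/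
theorem sum_norm_coef_le {a b : ℝ} (hab : a ≤ b) :
    ∑ n ∈ Ioc 0 (H + 1), ∑ n' ∈ Ioc 0 (H + 1), ‖coef H a b n n'‖ ≤
      (b - a) + 2 / Real.pi * (1 + Real.log (H + 1)) := by
  have hH : (0 : ℝ) < H + 1 := by positivity
  have hπ := Real.pi_pos
  have hHnorm : ‖(H : ℂ) + 1‖ = H + 1 := by
    rw [show ((H : ℂ) + 1) = ((H + 1 : ℝ) : ℂ) by push_cast; ring, Complex.norm_real, Real.norm_of_nonneg hH.le]
  -- diagonal and off-diagonal
  have hdiag : ∀ n ∈ Ioc 0 (H + 1), ‖coef H a b n n‖ = (b - a) / (H + 1) := by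
    intro n _
    rw [coef]
    have h1 : ∀ t : ℝ, (𝐞 (((n : ℝ) - n) * t) : ℂ) = 1 := fun t => by simp
    simp_rw [h1]
    rw [intervalIntegral.integral_const, norm_mul, norm_inv, hHnorm, norm_smul, norm_one, mul_one,
      Real.norm_of_nonneg (sub_nonneg.mpr hab)]
    field_simp
  have hoff : ∀ n ∈ Ioc 0 (H + 1), ∀ n' ∈ (Ioc 0 (H + 1)).erase n,
      ‖coef H a b n n'‖ ≤ (H + 1 : ℝ)⁻¹ * (1 / (Real.pi * |(((n : ℤ) - n' : ℤ) : ℝ)|)) := by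
    intro n _ n' hn'
    rw [mem_erase] at hn'
    rw [coef, norm_mul, norm_inv, hHnorm]
    refine mul_le_mul_of_nonneg_left ?_ (by positivity)
    have hc : ((n' : ℝ) - n) ≠ 0 := by
      have : (n' : ℝ) ≠ n := by exact_mod_cast hn'.1
      exact sub_ne_zero.mpr this
    refine (norm_integral_fourierChar_mul_le hc a b).trans (le_of_eq ?_)
    congr 2; push_cast; rw [abs_sub_comm]
  calc ∑ n ∈ Ioc 0 (H + 1), ∑ n' ∈ Ioc 0 (H + 1), ‖coef H a b n n'‖
      = ∑ n ∈ Ioc 0 (H + 1), (‖coef H a b n n‖ + ∑ n' ∈ (Ioc 0 (H + 1)).erase n, ‖coef H a b n n'‖) := by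
        refine sum_congr rfl fun n hn => ?_
        rw [← Finset.add_sum_erase _ _ hn]
    _ ≤ ∑ n ∈ Ioc 0 (H + 1), ((b - a) / (H + 1) +
          ∑ n' ∈ (Ioc 0 (H + 1)).erase n, (H + 1 : ℝ)⁻¹ * (1 / (Real.pi * |(((n : ℤ) - n' : ℤ) : ℝ)|))) := by
        refine sum_le_sum fun n hn => add_le_add (hdiag n hn).le (sum_le_sum fun n' hn' => hoff n hn n' hn')
    _ = (b - a) + (H + 1 : ℝ)⁻¹ * ∑ n ∈ Ioc 0 (H + 1), ∑ n' ∈ (Ioc 0 (H + 1)).erase n,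
          (1 / (Real.pi * |(((n : ℤ) - n' : ℤ) : ℝ)|)) := by
        rw [sum_add_distrib, sum_const, Nat.card_Ioc, Nat.sub_zero, nsmul_eq_mul, mul_sum]
        congr 1
        · push_cast; field_simp
        · refine sum_congr rfl fun n _ => ?_; rw [mul_sum]
    _ ≤ (b - a) + (H + 1 : ℝ)⁻¹ * ((H + 1) * ∑ d ∈ (Icc (-(H : ℤ)) H).erase 0, 1 / (Real.pi * |(d : ℝ)|)) := by
        refine add_le_add le_rfl (mul_le_mul_of_nonneg_left ?_ (by positivity))
        exact sum_sum_erase_le H (fun d => 1 / (Real.pi * |(d : ℝ)|)) fun d => by positivity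
    _ = (b - a) + ∑ d ∈ (Icc (-(H : ℤ)) H).erase 0, 1 / (Real.pi * |(d : ℝ)|) := by
        field_simp
    _ ≤ (b - a) + 2 / Real.pi * (1 + Real.log (H + 1)) := add_le_add le_rfl (sum_inv_abs_le H)

/-! ### The angular variable of a complex number -/

/-- The angular variable `θ(z) = arg z / 2π ∈ (-1/2, 1/2]`, so that `e(m θ(z)) = (z/|z|)^m`.
[folklore] -/
def angleFrac (z : ℂ) : ℝ := Complex.arg z / (2 * Real.pi)

/-- `-1/2 < θ(z) ≤ 1/2`. [folklore] -/
theorem angleFrac_mem (z : ℂ) : angleFrac z ∈ Set.Ioc (-(1 / 2) : ℝ) (1 / 2) := by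
  have h1 := Complex.neg_pi_lt_arg z
  have h2 := Complex.arg_le_pi z
  have hπ := Real.pi_pos
  constructor
  · rw [angleFrac, lt_div_iff₀ (by positivity)]; linarith
  · rw [angleFrac, div_le_iff₀ (by positivity)]; linarith

/-- **`e(m θ(z)) = (z/|z|)^m`** for `z ≠ 0` and an integer `m`. [folklore] -/
theorem fourierChar_intCast_mul_angleFrac {z : ℂ} (hz : z ≠ 0) (m : ℤ) :
    (𝐞 ((m : ℝ) * angleFrac z) : ℂ) = (z / (‖z‖ : ℂ)) ^ m := by
  have hunit : Complex.exp (Complex.arg z * Complex.I) = z / (‖z‖ : ℂ) := by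
    have h := Complex.norm_mul_exp_arg_mul_I z
    have hz' : (‖z‖ : ℂ) ≠ 0 := by exact_mod_cast norm_ne_zero_iff.mpr hz
    rw [eq_div_iff hz', mul_comm]; exact h
  rw [Real.fourierChar_apply, angleFrac, ← hunit, ← Complex.exp_int_mul]
  congr 1
  push_cast
  field_simp

/-- `z ↦ z/|z|` is multiplicative. [folklore] -/
theorem div_norm_mul (w z : ℂ) : w * z / (‖w * z‖ : ℂ) = (w / (‖w‖ : ℂ)) * (z / (‖z‖ : ℂ)) := by
  rw [norm_mul]; push_cast; rw [div_mul_div_comm]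

/-! ### The smoothed sign of the real part -/

/-- **The smoothed sign** `T_H(z) = 2 S_H(θ(z)) − 1` with `S_H` the smoothed indicator of the arc
`|θ| ≤ 1/4` (i.e. `Re z ≥ 0`). [cite: FriedlanderIwaniecAnnals1998, (20.16)–(20.17)] -/
def smoothSign (H : ℕ) (z : ℂ) : ℝ := 2 * smoothInd H (-(1 / 4)) (1 / 4) (angleFrac z) - 1

/-- `|T_H| ≤ 1`. [cite: FriedlanderIwaniecAnnals1998, (20.16)–(20.17)] -/
theorem abs_smoothSign_le (z : ℂ) : |smoothSign H z| ≤ 1 := by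
  have h0 := smoothInd_nonneg H (a := -(1 / 4)) (b := 1 / 4) (by norm_num) (angleFrac z)
  have h1 := smoothInd_le_one H (a := -(1 / 4)) (b := 1 / 4) (by norm_num) (by norm_num) (angleFrac z)
  rw [smoothSign, abs_le]; constructor <;> linarith

/-- Angular room on the right: if `Re z ≥ ρ |z| > 0` then `|arg z| ≤ π/2 − ρ`.
[cite: FriedlanderIwaniecAnnals1998, §20 ("stays away from the imaginary axis by an angle R⁻¹")] -/
theorem abs_arg_le_of_re_ge {z : ℂ} (hz : z ≠ 0) {ρ : ℝ} (hρ0 : 0 ≤ ρ) (hρ1 : ρ ≤ 1) (h : ρ * ‖z‖ ≤ z.re) :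
    |Complex.arg z| ≤ Real.pi / 2 - ρ := by
  have hzn : 0 < ‖z‖ := norm_pos_iff.mpr hz
  have hcos : ρ ≤ Real.cos (Complex.arg z) := by
    rw [Complex.cos_arg hz, le_div_iff₀ hzn]; exact h
  have habs : |Complex.arg z| = Real.arccos (Real.cos |Complex.arg z|) := by
    rw [Real.arccos_cos (abs_nonneg _) (Complex.abs_arg_le_pi z)]
  rw [habs, Real.cos_abs]
  calc Real.arccos (Real.cos (Complex.arg z)) ≤ Real.arccos ρ := Real.antitone_arccos hcos
    _ = Real.pi / 2 - Real.arcsin ρ := Real.arccos_eq_pi_div_two_sub_arcsin ρ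
    _ ≤ Real.pi / 2 - ρ := by
        have : ρ ≤ Real.arcsin ρ := by
          rw [Real.le_arcsin_iff_sin_le' ⟨by linarith [Real.pi_gt_three], by linarith [Real.pi_gt_three]⟩]
          exact Real.sin_le hρ0
        linarith

/-- Angular room on the left: if `Re z ≤ −ρ |z| < 0` then `|arg z| ≥ π/2 + ρ`.
[cite: FriedlanderIwaniecAnnals1998, §20] -/
theorem le_abs_arg_of_re_le {z : ℂ} (hz : z ≠ 0) {ρ : ℝ} (hρ0 : 0 ≤ ρ) (hρ1 : ρ ≤ 1) (h : z.re ≤ -(ρ * ‖z‖)) :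
    Real.pi / 2 + ρ ≤ |Complex.arg z| := by
  have hzn : 0 < ‖z‖ := norm_pos_iff.mpr hz
  have hcos : Real.cos (Complex.arg z) ≤ -ρ := by
    rw [Complex.cos_arg hz, div_le_iff₀ hzn]; linarith
  have habs : |Complex.arg z| = Real.arccos (Real.cos |Complex.arg z|) := by
    rw [Real.arccos_cos (abs_nonneg _) (Complex.abs_arg_le_pi z)]
  rw [habs, Real.cos_abs]
  calc Real.pi / 2 + ρ ≤ Real.pi / 2 + Real.arcsin ρ := by
        have : ρ ≤ Real.arcsin ρ := by
          rw [Real.le_arcsin_iff_sin_le' ⟨by linarith [Real.pi_gt_three], by linarith [Real.pi_gt_three]⟩]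
          exact Real.sin_le hρ0
        linarith
    _ = Real.arccos (-ρ) := by rw [Real.arccos_neg, Real.arccos_eq_pi_div_two_sub_arcsin]; ring
    _ ≤ Real.arccos (Real.cos (Complex.arg z)) := Real.antitone_arccos hcos

/-- **The smoothed sign is the sign, up to `2π/((H+1)ρ)`**, at every `z ≠ 0` with
`|Re z| ≥ ρ|z|` (`0 < ρ ≤ 1`): `|T_H(z) − sign(Re z)| ≤ 2π/((H+1)ρ)`. For `wz ≡ 1 (mod 2)`,
`|wz| ≤ R` one has `|Re wz| ≥ 1 ≥ |wz|/R`, i.e. `ρ = 1/R`, as in the source.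
[cite: FriedlanderIwaniecAnnals1998, (20.16)–(20.18)] -/
theorem abs_smoothSign_sub_sign_le {z : ℂ} (hz : z ≠ 0) {ρ : ℝ} (hρ0 : 0 < ρ) (hρ1 : ρ ≤ 1)
    (h : ρ * ‖z‖ ≤ |z.re|) : |smoothSign H z - Real.sign z.re| ≤ 2 * Real.pi / ((H + 1) * ρ) := by
  have hπ := Real.pi_pos
  have hzn : 0 < ‖z‖ := norm_pos_iff.mpr hz
  set δ : ℝ := ρ / (2 * Real.pi) with hδ
  have hδ0 : 0 < δ := by positivity
  have hδ2 : δ ≤ 1 / 2 := by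
    rw [hδ, div_le_iff₀ (by positivity)]; nlinarith [Real.pi_gt_three]
  have hbound : 1 / (2 * ((H : ℝ) + 1) * δ) = Real.pi / ((H + 1) * ρ) := by
    rw [hδ]; field_simp
  have hδ4 : δ ≤ 1 / 4 := by
    rw [hδ, div_le_iff₀ (by positivity)]; nlinarith [Real.pi_gt_three]
  have h2π : 2 * Real.pi / ((H + 1) * ρ) = 2 * (Real.pi / ((H + 1) * ρ)) := by ring
  have hre0 : z.re ≠ 0 := by
    intro h0; rw [h0, abs_zero] at h; nlinarith
  rcases lt_or_gt_of_ne hre0 with hneg | hpos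
  · -- `Re z < 0`: `θ(z)` is at distance `≥ δ` outside the arc
    rw [abs_of_neg hneg] at h
    have harg := le_abs_arg_of_re_le hz hρ0.le hρ1 (by linarith)
    rw [Real.sign_of_neg hneg]
    -- `S_H ≤ π/((H+1)ρ)` at `θ(z)` or at `θ(z) + 1`
    have hS : smoothInd H (-(1 / 4)) (1 / 4) (angleFrac z) ≤ 1 / (2 * (H + 1) * δ) := by
      have hθ := angleFrac_mem z
      rcases le_or_gt 0 (Complex.arg z) with harg0 | harg0
      · rw [abs_of_nonneg harg0] at harg
        refine smoothInd_le_of_not_mem H hδ0 hδ2 ?_ ?_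
        · rw [angleFrac, hδ, show (1 / 4 : ℝ) + ρ / (2 * Real.pi) = (Real.pi / 2 + ρ) / (2 * Real.pi) by field_simp; ring,
            div_le_div_iff_of_pos_right (by positivity)]; linarith
        · have := hθ.2; linarith
      · rw [abs_of_neg harg0] at harg
        rw [← smoothInd_add_intCast H _ _ (angleFrac z) 1]
        push_cast
        refine smoothInd_le_of_not_mem H hδ0 hδ2 ?_ ?_
        · have := hθ.1; linarith
        · rw [angleFrac, hδ]
          rw [show -(1 / 4 : ℝ) + 1 - ρ / (2 * Real.pi) = (3 * Real.pi / 2 - ρ) / (2 * Real.pi) by field_simp; ring,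
            show Complex.arg z / (2 * Real.pi) + 1 = (Complex.arg z + 2 * Real.pi) / (2 * Real.pi) by field_simp,
            div_le_div_iff_of_pos_right (by positivity)]
          linarith
    have hS0 := smoothInd_nonneg H (a := -(1 / 4)) (b := 1 / 4) (by norm_num) (angleFrac z)
    rw [smoothSign, abs_le]
    rw [hbound] at hS
    rw [h2π]
    constructor <;> linarith
  · -- `Re z > 0`: `θ(z)` is at distance `≥ δ` inside the arc
    rw [abs_of_pos hpos] at h
    have harg := abs_arg_le_of_re_ge hz hρ0.le hρ1 h
    rw [Real.sign_of_pos hpos]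
    have hS : 1 - 1 / (2 * (H + 1) * δ) ≤ smoothInd H (-(1 / 4)) (1 / 4) (angleFrac z) := by
      rw [abs_le] at harg
      refine le_smoothInd_of_mem H hδ0 hδ2 ?_ ?_
      · rw [angleFrac, hδ, show -(1 / 4 : ℝ) + ρ / (2 * Real.pi) = (-(Real.pi / 2) + ρ) / (2 * Real.pi) by field_simp; ring,
          div_le_div_iff_of_pos_right (by positivity)]
        linarith
      · rw [angleFrac, hδ, show (1 / 4 : ℝ) - ρ / (2 * Real.pi) = (Real.pi / 2 - ρ) / (2 * Real.pi) by field_simp; ring,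
          div_le_div_iff_of_pos_right (by positivity)]
        linarith
    have hS1 := smoothInd_le_one H (a := -(1 / 4)) (b := 1 / 4) (by norm_num) (by norm_num) (angleFrac z)
    rw [smoothSign, abs_le]
    rw [hbound] at hS
    rw [h2π]
    constructor <;> linarith

/-- **The smoothed sign as a finite sum of angular characters** (the separation (20.19)):
`T_H(z) = Σ_{n,n' ≤ H+1} 2γ(n,n') (z/|z|)^{n−n'} − 1` for `z ≠ 0`, where the coefficients satisfy
`Σ |2γ(n,n')| ≤ 1 + (4/π)(1 + log(H+1))` (`sum_norm_coef_le`); and `(wz/|wz|)^m = (w/|w|)^m (z/|z|)^m`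
(`div_norm_mul`). [cite: FriedlanderIwaniecAnnals1998, (20.17)–(20.19)] -/
theorem smoothSign_eq_sum {z : ℂ} (hz : z ≠ 0) : (smoothSign H z : ℂ) =
    ∑ n ∈ Ioc 0 (H + 1), ∑ n' ∈ Ioc 0 (H + 1),
      2 * coef H (-(1 / 4)) (1 / 4) n n' * (z / (‖z‖ : ℂ)) ^ ((n : ℤ) - n') - 1 := by
  rw [smoothSign]
  push_cast
  rw [smoothInd_eq_sum, mul_sum]
  congr 1
  refine sum_congr rfl fun n _ => ?_
  rw [mul_sum]
  refine sum_congr rfl fun n' _ => ?_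
  rw [← fourierChar_intCast_mul_angleFrac hz]
  push_cast; ring

/-- The `ℓ¹` norm of the coefficients of `T_H`: `Σ_{n,n'} ‖2γ(n,n')‖ ≤ 1 + (4/π)(1 + log(H+1))`
(`≪ log 2H`, (20.18)). [cite: FriedlanderIwaniecAnnals1998, (20.18)] -/
theorem sum_norm_two_mul_coef_le :
    ∑ n ∈ Ioc 0 (H + 1), ∑ n' ∈ Ioc 0 (H + 1), ‖2 * coef H (-(1 / 4)) (1 / 4) n n'‖ ≤
      1 + 4 / Real.pi * (1 + Real.log (H + 1)) := by
  have h := sum_norm_coef_le H (a := -(1 / 4)) (b := 1 / 4) (by norm_num)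
  have h2 : ∑ n ∈ Ioc 0 (H + 1), ∑ n' ∈ Ioc 0 (H + 1), ‖2 * coef H (-(1 / 4)) (1 / 4) n n'‖ =
      2 * ∑ n ∈ Ioc 0 (H + 1), ∑ n' ∈ Ioc 0 (H + 1), ‖coef H (-(1 / 4)) (1 / 4) n n'‖ := by
    rw [mul_sum]; refine sum_congr rfl fun n _ => ?_
    rw [mul_sum]; refine sum_congr rfl fun n' _ => ?_
    rw [norm_mul, RCLike.norm_ofNat]
  rw [h2]
  norm_num at h ⊢
  have : 4 / Real.pi * (1 + Real.log (H + 1)) = 2 * (2 / Real.pi * (1 + Real.log (H + 1))) := by ring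
  linarith

/-! ### Separation of variables in `sign(Re wz)` inside a double sum -/

/-- **Separation of `sign(Re wz)`** (the use of (20.19) in Propositions 21.4 and 23.1): for finite
families `w_i`, `z_j` of complex numbers with `|Re(w_i z_j)| ≥ ρ |w_i z_j| > 0` (`0 < ρ ≤ 1`), any
weights `F(i, j)`, any `H`, and any `M` bounding all the twisted sums
`‖ΣΣ (w_i/|w_i|)^d (z_j/|z_j|)^d F(i,j)‖ ≤ M` (`|d| ≤ H`):
`‖ΣΣ sign(Re(w_i z_j)) F(i,j)‖ ≤ (2 + (4/π)(1 + log(H+1))) M + (2π/((H+1)ρ)) ΣΣ ‖F(i,j)‖`.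
[cite: FriedlanderIwaniecAnnals1998, (20.15)–(20.19)] -/
theorem norm_sum_sum_sign_mul_le {ι κ : Type*} (W : Finset ι) (Z : Finset κ) (w : ι → ℂ) (z : κ → ℂ)
    (F : ι → κ → ℂ) {ρ : ℝ} (hρ0 : 0 < ρ) (hρ1 : ρ ≤ 1)
    (hsep : ∀ i ∈ W, ∀ j ∈ Z, w i * z j ≠ 0 ∧ ρ * ‖w i * z j‖ ≤ |(w i * z j).re|)
    {M : ℝ} (hM : ∀ d : ℤ, |d| ≤ H →
      ‖∑ i ∈ W, ∑ j ∈ Z, (w i / (‖w i‖ : ℂ)) ^ d * (z j / (‖z j‖ : ℂ)) ^ d * F i j‖ ≤ M) :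
    ‖∑ i ∈ W, ∑ j ∈ Z, (Real.sign (w i * z j).re : ℂ) * F i j‖ ≤
      (2 + 4 / Real.pi * (1 + Real.log (H + 1))) * M + 2 * Real.pi / ((H + 1) * ρ) * ∑ i ∈ W, ∑ j ∈ Z, ‖F i j‖ := by
  have hM0 : 0 ≤ M := le_trans (norm_nonneg _) (hM 0 (by simp))
  -- pointwise decomposition `sign = T_H + (sign − T_H)`
  have hpt : ∀ i ∈ W, ∀ j ∈ Z, (Real.sign (w i * z j).re : ℂ) * F i j =
      (∑ n ∈ Ioc 0 (H + 1), ∑ n' ∈ Ioc 0 (H + 1), 2 * coef H (-(1 / 4)) (1 / 4) n n' *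
        ((w i / (‖w i‖ : ℂ)) ^ ((n : ℤ) - n') * (z j / (‖z j‖ : ℂ)) ^ ((n : ℤ) - n') * F i j)) -
        F i j + ((Real.sign (w i * z j).re - smoothSign H (w i * z j) : ℝ) : ℂ) * F i j := by
    intro i hi j hj
    have hne := (hsep i hi j hj).1
    have hT := smoothSign_eq_sum H hne
    have hsplit : (Real.sign (w i * z j).re : ℂ) = (smoothSign H (w i * z j) : ℂ) +
        ((Real.sign (w i * z j).re - smoothSign H (w i * z j) : ℝ) : ℂ) := by push_cast; ring
    rw [hsplit, add_mul, hT, sub_mul, sum_mul, one_mul]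
    congr 2
    refine sum_congr rfl fun n _ => ?_
    rw [sum_mul]
    refine sum_congr rfl fun n' _ => ?_
    rw [div_norm_mul, mul_zpow]; ring
  rw [sum_congr rfl fun i hi => sum_congr rfl fun j hj => hpt i hi j hj]
  simp_rw [sum_add_distrib, sum_sub_distrib]
  -- swap the sums in the main part
  have hswap : ∑ i ∈ W, ∑ j ∈ Z, ∑ n ∈ Ioc 0 (H + 1), ∑ n' ∈ Ioc 0 (H + 1),
      2 * coef H (-(1 / 4)) (1 / 4) n n' * ((w i / (‖w i‖ : ℂ)) ^ ((n : ℤ) - n') * (z j / (‖z j‖ : ℂ)) ^ ((n : ℤ) - n') * F i j) =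
      ∑ n ∈ Ioc 0 (H + 1), ∑ n' ∈ Ioc 0 (H + 1), 2 * coef H (-(1 / 4)) (1 / 4) n n' *
        ∑ i ∈ W, ∑ j ∈ Z, (w i / (‖w i‖ : ℂ)) ^ ((n : ℤ) - n') * (z j / (‖z j‖ : ℂ)) ^ ((n : ℤ) - n') * F i j := by
    have s1 : ∀ i, ∑ j ∈ Z, ∑ n ∈ Ioc 0 (H + 1), ∑ n' ∈ Ioc 0 (H + 1),
        2 * coef H (-(1 / 4)) (1 / 4) n n' * ((w i / (‖w i‖ : ℂ)) ^ ((n : ℤ) - n') * (z j / (‖z j‖ : ℂ)) ^ ((n : ℤ) - n') * F i j) =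
        ∑ n ∈ Ioc 0 (H + 1), ∑ n' ∈ Ioc 0 (H + 1), ∑ j ∈ Z,
        2 * coef H (-(1 / 4)) (1 / 4) n n' * ((w i / (‖w i‖ : ℂ)) ^ ((n : ℤ) - n') * (z j / (‖z j‖ : ℂ)) ^ ((n : ℤ) - n') * F i j) := by
      intro i
      rw [Finset.sum_comm]
      exact sum_congr rfl fun n _ => Finset.sum_comm
    simp_rw [s1]
    rw [Finset.sum_comm]
    refine sum_congr rfl fun n _ => ?_
    rw [Finset.sum_comm]
    refine sum_congr rfl fun n' _ => ?_
    rw [mul_sum]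
    refine sum_congr rfl fun i _ => ?_
    rw [mul_sum]
  rw [hswap]
  -- bound the three parts
  have h1 : ‖∑ n ∈ Ioc 0 (H + 1), ∑ n' ∈ Ioc 0 (H + 1), 2 * coef H (-(1 / 4)) (1 / 4) n n' *
      ∑ i ∈ W, ∑ j ∈ Z, (w i / (‖w i‖ : ℂ)) ^ ((n : ℤ) - n') * (z j / (‖z j‖ : ℂ)) ^ ((n : ℤ) - n') * F i j‖ ≤
      (1 + 4 / Real.pi * (1 + Real.log (H + 1))) * M := by
    calc _ ≤ ∑ n ∈ Ioc 0 (H + 1), ∑ n' ∈ Ioc 0 (H + 1), ‖2 * coef H (-(1 / 4)) (1 / 4) n n'‖ * M := by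
          refine (norm_sum_le _ _).trans (sum_le_sum fun n hn => (norm_sum_le _ _).trans (sum_le_sum fun n' hn' => ?_))
          rw [norm_mul]
          refine mul_le_mul_of_nonneg_left (hM _ ?_) (norm_nonneg _)
          rw [mem_Ioc] at hn hn'
          rw [abs_le]; constructor <;> omega
      _ = (∑ n ∈ Ioc 0 (H + 1), ∑ n' ∈ Ioc 0 (H + 1), ‖2 * coef H (-(1 / 4)) (1 / 4) n n'‖) * M := by
          rw [sum_mul]; refine sum_congr rfl fun n _ => ?_; rw [sum_mul]
      _ ≤ (1 + 4 / Real.pi * (1 + Real.log (H + 1))) * M :=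
          mul_le_mul_of_nonneg_right (sum_norm_two_mul_coef_le H) hM0
  have h2 : ‖∑ i ∈ W, ∑ j ∈ Z, F i j‖ ≤ M := by
    have := hM 0 (by simp)
    simpa using this
  have h3 : ‖∑ i ∈ W, ∑ j ∈ Z, ((Real.sign (w i * z j).re - smoothSign H (w i * z j) : ℝ) : ℂ) * F i j‖ ≤
      2 * Real.pi / ((H + 1) * ρ) * ∑ i ∈ W, ∑ j ∈ Z, ‖F i j‖ := by
    rw [mul_sum]
    refine (norm_sum_le _ _).trans (sum_le_sum fun i hi => ?_)
    rw [mul_sum]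
    refine (norm_sum_le _ _).trans (sum_le_sum fun j hj => ?_)
    rw [norm_mul, Complex.norm_real, Real.norm_eq_abs, abs_sub_comm]
    obtain ⟨hne, hre⟩ := hsep i hi j hj
    exact mul_le_mul_of_nonneg_right (abs_smoothSign_sub_sign_le H hne hρ0 hρ1 hre) (norm_nonneg _)
  calc _ ≤ ‖∑ n ∈ Ioc 0 (H + 1), ∑ n' ∈ Ioc 0 (H + 1), 2 * coef H (-(1 / 4)) (1 / 4) n n' *
          ∑ i ∈ W, ∑ j ∈ Z, (w i / (‖w i‖ : ℂ)) ^ ((n : ℤ) - n') * (z j / (‖z j‖ : ℂ)) ^ ((n : ℤ) - n') * F i j -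
          ∑ i ∈ W, ∑ j ∈ Z, F i j‖ +
        ‖∑ i ∈ W, ∑ j ∈ Z, ((Real.sign (w i * z j).re - smoothSign H (w i * z j) : ℝ) : ℂ) * F i j‖ :=
        norm_add_le _ _
    _ ≤ ((1 + 4 / Real.pi * (1 + Real.log (H + 1))) * M + M) + 2 * Real.pi / ((H + 1) * ρ) * ∑ i ∈ W, ∑ j ∈ Z, ‖F i j‖ :=
        add_le_add ((norm_sub_le _ _).trans (add_le_add h1 h2)) h3
    _ = _ := by ring

end Literature.NumberTheory.Sieve.FejerSmoothing
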